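import Literature.MathematicalPhysics.QuantumFieldTheory.Balaban1983to89.B8Eq191FlatDirichletDepth
import Literature.MathematicalPhysics.QuantumFieldTheory.Balaban1983to89.B8Ineq198MultiLevelBox

/-!
# `Balaban1983to89.B8CubeMemberBoxDomains` — [Balaban1985RegularSpaces] p. 98–99: THE INNER CUBE FAMILY `□₁ ⊃ □₂ ⊃ … ⊃ □_n` OF (1.131)
# IS A MEMBER OF THE [B6] §2 NEUMANN-BOX FAMILY `B6MultiLevelBoxOperator.Domains` — and r05's HYPOTHESIS-FREE (1.101) on that family READ AT IT

statement-level skeleton of published theorems with citation tags; proofs where landed; nothing here is a claim about the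
Yang–Mills mass gap

`[Balaban1985RegularSpaces]` ("B8", CMP **99** (1985) 75–102) p. 98 («Let us take a sequence of cubes □₀, □₁, …, □_{k−1}, □_k, □, such that
□_j ⊃ □_{j+1} and a distance between boundaries of these cubes is equal to R₁M₁Lʲη … for every j the cube □_j is a sum of the big blocks of the
lattice T_{L^{−j}}», «R₁, M₁ are smallest integers for which all the theorems of the papers [2, 4] are valid», «M is a multiple of R₁M₁»),
(1.131) p. 99, (1.101) p. 93; `[Balaban1984PropagatorsII]` ("B6", CMP **96** (1984) 223–250) (2.1)–(2.4) p. 224 («Ω_j^{(j)} ⊂ T^{(j)} is a sum of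
big blocks … (Lʲη)⁻¹dist(Ω_jᶜ, Ω_{j+1}) > RM, where M is a size of big blocks and R is a big positive integer fixed later»);
`[Balaban1985BackgroundPropagators]` ("[4]") Theorem 3.1 p. 397.  PDF held: `paper:balaban1985-cmp99-regular-spaces-gauge-fixing` (journal page = PDF page + 74),
p. 98–99 re-read this generation.

CITATION HEADER (lean-in-tree rule).  Cell `pub-ymgap` (YM Track A, HUMAN RULING D-0062), DAG node N05 = [B8], seat `pub-ymgap-dag-n05-c` (g9; R134 (a)
row s1; the (R1′) programme of this base = the three REAL inequality families of `B8Prop6CubeMemberFlatScalar.prop6_cubeMember_flat_of_real` (n05-e), i.e.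
[4] Thms 3.1–3.2 at `U = 1` on the explicit flat multi-level matrices of the cube member).  THE LOCATED FACT THIS FILE ACTS ON: (1.101) — and (1.92),
(1.98), THE inverse `(Q′G′²Q′*)⁻¹` — are HYPOTHESIS-FREE THEOREMS in the tree on p21's `k`-level NEUMANN-BOX family `B6MultiLevelBoxOperator.Domains d ℓ M_h k P R`
(an ARBITRARY nested block-union family `X = Ω₁ ⊃ … ⊃ Ω_k` with (2.1)–(2.2); r05's `B8Ineq198MultiLevelBox.ineq1101_multiLevelBox(_two)`,
`…ineq198R_multiLevelBox`, `B8Ineq192MultiLevelBox(P23)`, p21's `B6Prop22AllMultiLevelBox.prop22_entries1236_multiLevelBox`, `B6Prop23MultiLevelBox`).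
Its fine sites `Fin (d+1) → ℤ` ARE the cube member's sites, its block map `B4Reflection242.blk` IS `QuantumLattice.blockMap`, and the entries of its
operator `mlOp` (`mlOp_apply`: `neumannLapK + avgK (levC a (lev x)) (L^{lev x})`) are the consumer's `K`-rows at interior sites of `□₁` up to the factor `η⁻²`
(weights `w_j = η⁻²·a_j·L^{(d−1)j}` in dimension `d + 1`).  THIS FILE makes the inner cube family a MEMBER of that family, so that the deep-level elliptic
regularity behind (1.101) is imported BY NAME instead of being re-proved on the Dirichlet carrier (this base's g8 memo `R1PRIME-PROGRAMME.md`, brick 5).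

WHAT THIS FILE PROVES (kernel-checked; `L = ℓ + 1`; cube datum `(a, M, ρ, k)` of `B8Eq131Cubes` with `ρ = R₁M₁`, truncation `1 ≤ n ≤ k`; big-block
compatibility = `M_h·L ∣ ρ` and `M_h·L ∣ M` (print: «□_j is a sum of the big blocks», «M is a multiple of R₁M₁»; `M_h·L` = [B6]'s big-block size in units
of the level), collar law `R·(M_h·L) ≤ ρ` (print: `ρ = R₁M₁ = R·M₁`)).
* §1 `shift` (the translation `t` putting the lower corner of `□_n` at `M_hL^{n+1}·ρ`), `boxP` (the side multipliers `P_μ = ρ + L^{k−n}(M + 2ρ)` of the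
  host box `X = Π_μ[0, Lⁿ·L·M_h·P_μ)`), `lev` (the deepest `j ≤ n` with `y − t ∈ □_j`, `1` off `t + □₁`).
* §2 arithmetic: `le_lev_iff` (`j ≤ lev y ⇔ y − t ∈ □_j`, `2 ≤ j ≤ n`), the big-block divisibility of the margins `m_j = Lʲ·ρ·Σ_{i≤k−j}Lⁱ` and of the core
  side (`bigSide_dvd_fm`, `bigSide_dvd_core`, `bigSide_dvd_anchor`), ★ `corners_on_grid` (both corners of every `t + □_j`, `j ≤ n`, lie on `(M_hL^{j+1})ℤ^{d+1}`),
  `inBox_iff_of_grid`, ★ `mem_cube_iff_of_blk_eq` ((2.1): membership in `t + □_j` depends only on the big `j`-block), `collar_gap` (a site outside `□_j` and a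
  site in `□_{j+1}` differ by `> ρLʲ` in some coordinate), `fm_one_le` ∕ `fm_one_le_top` (the outer margins add up to `< ρLⁿ`, p. 98's
  «Σ R₁M₁Lʲη ≤ 2R₁M₁Lᵏη»).
* §3 ★ `mem_boxDom_of_mem_cube` (`t + □₁ ⊂ X`), ★★ `cubeDomains : Domains d ℓ M_h n (boxP …) R` — THE MEMBER: `lev`, `1 ≤ lev ≤ n`, (2.1) `bigBlocks`, (2.2) `sep`
  (`R·M_hL^{j+1} ≤ ρLʲ < dist_∞`); `cubeDomains_lev` (`rfl`).
* §4 dictionary with the cube member's towers (`B8CubeMemberZd.cubeLamS`, truncation `n`): ★ `lev_eq_of_tower` ∕ `tower_iff_lev_eq` — for `x ∈ □₁`,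
  `blockMap (Lʲ) x ∈ cubeLamS … n j ⇔ lev (x + t) = j` (by g8's `mem_cube_of_le_tower` ∕ `not_mem_cube_of_tower_lt` and `cover_cubeMember`).
* §5 ★ `ineq1101_regionA` — r05's `ineq1101_multiLevelBox_two` READ AT THE MEMBER (by `exact`): (1.101)'s four entries for `G′ = gml … lev a` on `X`, constants
  `C′, M₀, N₀` depending on `d, ℓ` and the weight windows only, thresholds `3 ≤ M_h`, `M₀ ≤ L·M_h`, `2L ≤ R`, `N₀ + 1 ≤ R·L·M_h` — the region-A input of the
  two-region parametrix for (1.101) on the consumer's Dirichlet carrier (successor file `B8Eq1101CubeMemberParametrix`).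

HONEST SCOPE ∕ NOT CLAIMED.  Geometry and bookkeeping plus ONE application of a landed theorem; no estimate is proved here.  The member carries the
consumer's levels `1 … n` on `t + □₁` and level `1` on `X ∖ (t + □₁)` (p21's family has no level `0` and `Ω₁ = X`): its operator `mlOp` agrees with the
consumer's explicit Dirichlet matrix `T` of `prop6_cubeMember_flat_of_real` ONLY in the rows of interior sites of `□₁` (the successor's row dictionary) —
NOT on the level-0 collar `□₀ ∖ □₁` and NOT at `∂□₁`; the consumer's (1.101) therefore still needs the wall estimate and the parametrix (successor files).
The arithmetic side conditions (`M_hL ∣ ρ`, `M_hL ∣ M`, `R·M_hL ≤ ρ`, `M_h ≥ 3`, `2L ≤ R`, r05's thresholds) are print's «R₁, M₁ smallest integers for which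
all the theorems of [2, 4] are valid», «M a multiple of R₁M₁» made explicit; the consumer quantifies `∀ M ρ` with `L ≤ ρ ≤ M` only, so the three REAL
families will be supplied on this sub-lattice of data (LOCATED-ρ of this base, bus l.19153, now in print's own form).  Count-neutral; N05 NOT discharged;
one finite `T⁴` programme at fixed `ε`, Bałaban as printed; nothing continuum ∕ ℝ⁴ ∕ OS ∕ mass-gap ∕ Clay.  No `sorry`, no `instance`, no `notation`;
three `def`s (`shift`, `boxP`, `lev`) and one structure-valued `def` (`cubeDomains`).  Unit `pub-ymgap-dag-n05-c` (g9), 2026-08-27.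

RELATED IN THE TREE, NOT DUPLICATED (`rg` 2026-08-27T14:05Z: `Domains.top` is the only other `Domains` term; no file mentions both `cubeLamS` and `boxDom`):
`B6MultiLevelBoxOperator.*`, `B8Ineq198MultiLevelBox.*` (USED BY NAME), `B8Eq131Cubes.*`, `B8CubeMemberZd.*`, `B8Eq191FlatDirichletDepth.*`,
`B8Eq191FlatDirichletConjugation.cover_cubeMember`, `B8Eq191FlatLettersCubeMember.*` (USED BY NAME); the torus-with-level-0 [B6] chain commissioned as
lit-balaban row G-F3′-L0 (director-ym LINE №27) is a different carrier (`TDomains₀`) and is not touched.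
-/
noncomputable section

namespace Literature.MathematicalPhysics.QuantumFieldTheory.Balaban1983to89.B8CubeMemberBoxDomains

open B6MultiLevelBoxOperator (Domains N0 bigSide)
open B4Reflection242 (boxDom mem_boxDom blk)
open B4ContourShift (supNorm abs_le_supNorm)
open B7Prop1Local (InBox)
open B8Eq131Cubes (gs cube bLo bHi)
open B8Eq191FlatDirichletDepth (fm loC hiC mem_cube_iff_inBox fm_succ fm_add_le)

variable {d : ℕ}

/-! ## §1 The aligning translation, the presentation of the box, the level function -/

/-- The translation `t` carrying `□_n` to a cube with lower corner `M_h L^{n+1}·ρ` (all `□_j`, `j ≤ n`, then have corners on the grid of the big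
`j`-blocks `(M_h L^{j+1})ℤ^{d+1}` when `M_h L ∣ ρ`, `M_h L ∣ M`). [cite: Balaban1985RegularSpaces, p.98 («for every j the cube □_j is a sum of the big blocks of the lattice T_{L^{−j}}»); Balaban1984PropagatorsII, (2.1) p.224] -/
def shift (ℓ Mh : ℕ) (a : Fin (d + 1) → ℤ) (ρ k n : ℕ) : Fin (d + 1) → ℤ :=
  fun i => ((Mh * (ℓ + 1) ^ (n + 1) * ρ : ℕ) : ℤ) - loC (ℓ + 1) a ρ k n i

/-- The side multipliers `P_μ = ρ + L^{k−n}(M + 2ρ)` of the Neumann box `X = Π_μ [0, L^n·L·M_h·P_μ)` that hosts the translated `□₁`.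
[cite: Balaban1984PropagatorsII, (2.1) p.224; Balaban1985RegularSpaces, p.98] -/
def boxP (ℓ M ρ k n : ℕ) : Fin (d + 1) → ℕ := fun _ => ρ + (ℓ + 1) ^ (k - n) * (M + 2 * ρ)

open Classical in
/-- The level function of the translated inner family at truncation `n`: the deepest `j ≤ n` with `y − t ∈ □_j`, and `1` off `□₁`
(`Ω₁ = X`, [B6] p. 224 «we admit the case when some domains Ω_j are equal to T_η»). [cite: Balaban1984PropagatorsII, (2.3)–(2.4) p.224; Balaban1985RegularSpaces, (1.131) p.99, (1.68) p.88] -/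
def lev (ℓ Mh : ℕ) (a : Fin (d + 1) → ℤ) (M ρ k n : ℕ) (y : Fin (d + 1) → ℤ) : ℕ :=
  max 1 (Nat.findGreatest (fun j => y - shift ℓ Mh a ρ k n ∈ cube (ℓ + 1) a M ρ k j) n)

/-! ## §2 Arithmetic of the margins -/

/-- `1 ≤ lev`. [cite: Balaban1984PropagatorsII, (2.3)–(2.4) p.224] -/
theorem one_le_lev (ℓ Mh : ℕ) (a : Fin (d + 1) → ℤ) (M ρ k n : ℕ) (y : Fin (d + 1) → ℤ) : 1 ≤ lev ℓ Mh a M ρ k n y :=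
  le_max_left _ _

/-- `lev ≤ n` (`1 ≤ n`). [cite: Balaban1984PropagatorsII, (2.3)–(2.4) p.224] -/
theorem lev_le (ℓ Mh : ℕ) (a : Fin (d + 1) → ℤ) (M ρ k : ℕ) {n : ℕ} (hn : 1 ≤ n) (y : Fin (d + 1) → ℤ) : lev ℓ Mh a M ρ k n y ≤ n := by
  classical
  exact max_le hn (Nat.findGreatest_le n)

open Classical in
/-- For `2 ≤ j ≤ n`: `j ≤ lev y ⇔ y − t ∈ □_j` (`Ω_j = {j ≤ lev}` is the translated `□_j`). [cite: Balaban1984PropagatorsII, (2.3)–(2.4) p.224; Balaban1985RegularSpaces, (1.3) p.77, (1.131) p.99] -/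
theorem le_lev_iff {ℓ Mh : ℕ} (a : Fin (d + 1) → ℤ) (M : ℕ) {ρ k n j : ℕ} (hρ : ℓ + 1 ≤ ρ) (hnk : n ≤ k) (hj : 1 ≤ j) (hjn : j ≤ n)
    (y : Fin (d + 1) → ℤ) (hy1 : j = 1 → y - shift ℓ Mh a ρ k n ∈ cube (ℓ + 1) a M ρ k 1) :
    j ≤ lev ℓ Mh a M ρ k n y ↔ y - shift ℓ Mh a ρ k n ∈ cube (ℓ + 1) a M ρ k j := by
  have hL : 1 ≤ ℓ + 1 := Nat.succ_pos ℓ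
  unfold lev
  constructor
  · intro h
    rcases le_max_iff.mp h with h1 | h2
    · obtain rfl : j = 1 := le_antisymm h1 hj
      exact hy1 rfl
    · -- `y − t ∈ □_m` for the greatest such `m ≥ j`, and `□_m ⊂ □_j`
      set m := Nat.findGreatest (fun j => y - shift ℓ Mh a ρ k n ∈ cube (ℓ + 1) a M ρ k j) n with hm
      have hm0 : m ≠ 0 := by omega
      have hPm : y - shift ℓ Mh a ρ k n ∈ cube (ℓ + 1) a M ρ k m := (Nat.findGreatest_eq_iff.mp hm.symm).2.1 hm0
      have hmn : m ≤ n := Nat.findGreatest_le n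
      have hsub := B8Eq191FlatLettersCubeMember.cubeFam_antitone hL a M hρ k h2
      rw [B8Eq131CubesAdmissible.cubeFam_false_of_le _ a M ρ (hmn.trans hnk),
        B8Eq131CubesAdmissible.cubeFam_false_of_le _ a M ρ (hjn.trans hnk)] at hsub
      exact hsub hPm
  · intro h
    exact le_max_of_le_right (Nat.le_findGreatest hjn h)

open Classical in
/-- `lev y = m` with `1 ≤ m` forces `y − t ∈ □_m` unless `m = 1`, and `y − t ∉ □_{m'}` for `m < m' ≤ n`. [cite: Balaban1984PropagatorsII, (2.3)–(2.4) p.224] -/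
theorem not_mem_of_lev_lt {ℓ Mh : ℕ} (a : Fin (d + 1) → ℤ) (M ρ k : ℕ) {n m' : ℕ} (y : Fin (d + 1) → ℤ)
    (hlt : lev ℓ Mh a M ρ k n y < m') (hm' : m' ≤ n) : y - shift ℓ Mh a ρ k n ∉ cube (ℓ + 1) a M ρ k m' := by
  intro h
  have := Nat.le_findGreatest (P := fun j => y - shift ℓ Mh a ρ k n ∈ cube (ℓ + 1) a M ρ k j) hm' h
  unfold lev at hlt
  omega

/-- The margins `m_{j'}` with `j ≤ j'` are multiples of `M_h L^{j+1}` when `M_h L ∣ ρ` (`m_{j'} = L^{j'}·ρ·Σ Lⁱ`). [cite: Balaban1985RegularSpaces, p.98; Balaban1984PropagatorsII, (2.1) p.224] -/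
theorem bigSide_dvd_fm {ℓ Mh ρ : ℕ} (hρ : Mh * (ℓ + 1) ∣ ρ) (k : ℕ) {j j' : ℕ} (hjj : j ≤ j') :
    bigSide ℓ Mh j ∣ fm (ℓ + 1) ρ k j' := by
  obtain ⟨q, hq⟩ := hρ
  obtain ⟨e, he⟩ := Nat.exists_eq_add_of_le hjj
  refine ⟨(ℓ + 1) ^ e * q * gs (ℓ + 1) (k - j'), ?_⟩
  unfold fm bigSide
  rw [hq, he, pow_add, pow_succ]
  ring

/-- `M_h L^{j+1} ∣ L^k·M` for `j ≤ k` when `M_h L ∣ M`. [cite: Balaban1985RegularSpaces, p.98 («M is a multiple of R₁M₁»)] -/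
theorem bigSide_dvd_core {ℓ Mh M : ℕ} (hM : Mh * (ℓ + 1) ∣ M) {k j : ℕ} (hjk : j ≤ k) :
    bigSide ℓ Mh j ∣ (ℓ + 1) ^ k * M := by
  obtain ⟨q, hq⟩ := hM
  obtain ⟨e, he⟩ := Nat.exists_eq_add_of_le hjk
  refine ⟨(ℓ + 1) ^ e * q, ?_⟩
  unfold bigSide
  rw [hq, he, pow_add, pow_succ]
  ring

/-- `M_h L^{j+1} ∣ M_h L^{n+1}·ρ` for `j ≤ n`. [folklore] [cite: Balaban1984PropagatorsII, (2.1) p.224] -/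
theorem bigSide_dvd_anchor (ℓ Mh ρ : ℕ) {n j : ℕ} (hjn : j ≤ n) : bigSide ℓ Mh j ∣ Mh * (ℓ + 1) ^ (n + 1) * ρ := by
  obtain ⟨e, he⟩ := Nat.exists_eq_add_of_le hjn
  refine ⟨(ℓ + 1) ^ e * ρ, ?_⟩
  unfold bigSide
  rw [he, show j + e + 1 = (j + 1) + e by omega, pow_add]
  ring

/-- **THE CORNERS OF THE TRANSLATED CUBES LIE ON THE BIG-BLOCK GRID**: for `1 ≤ j ≤ n` there are integers `α, β` with
`loC_j + t = M_hL^{j+1}·α` and `hiC_j + 1 + t = M_hL^{j+1}·β` (coordinatewise, the same for every coordinate direction's formula).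
[cite: Balaban1985RegularSpaces, p.98 («for every j the cube □_j is a sum of the big blocks of the lattice T_{L^{−j}}»); Balaban1984PropagatorsII, (2.1) p.224] -/
theorem corners_on_grid {ℓ Mh : ℕ} (a : Fin (d + 1) → ℤ) {M ρ k n j : ℕ} (hρ : Mh * (ℓ + 1) ∣ ρ) (hM : Mh * (ℓ + 1) ∣ M)
    (hjn : j ≤ n) (hnk : n ≤ k) (i : Fin (d + 1)) :
    (∃ α : ℤ, loC (ℓ + 1) a ρ k j i + shift ℓ Mh a ρ k n i = (bigSide ℓ Mh j : ℤ) * α) ∧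
    (∃ β : ℤ, hiC (ℓ + 1) a M ρ k j i + 1 + shift ℓ Mh a ρ k n i = (bigSide ℓ Mh j : ℤ) * β) := by
  obtain ⟨q₁, hq₁⟩ := bigSide_dvd_fm hρ k (le_refl j)
  obtain ⟨q₂, hq₂⟩ := bigSide_dvd_fm hρ k hjn
  obtain ⟨q₃, hq₃⟩ := bigSide_dvd_anchor ℓ Mh ρ hjn
  obtain ⟨q₄, hq₄⟩ := bigSide_dvd_core hM (hjn.trans hnk)
  have e1 : loC (ℓ + 1) a ρ k j i + shift ℓ Mh a ρ k n i
      = ((Mh * (ℓ + 1) ^ (n + 1) * ρ : ℕ) : ℤ) + (fm (ℓ + 1) ρ k n : ℤ) - (fm (ℓ + 1) ρ k j : ℤ) := by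
    unfold shift loC; simp only [bLo]; push_cast; ring
  have e2 : hiC (ℓ + 1) a M ρ k j i + 1 + shift ℓ Mh a ρ k n i
      = (((ℓ + 1) ^ k * M : ℕ) : ℤ) + (fm (ℓ + 1) ρ k j : ℤ) + ((Mh * (ℓ + 1) ^ (n + 1) * ρ : ℕ) : ℤ) + (fm (ℓ + 1) ρ k n : ℤ) := by
    unfold shift hiC loC; simp only [bHi, bLo]; push_cast; ring
  constructor
  · refine ⟨(q₃ : ℤ) + q₂ - q₁, ?_⟩
    rw [e1, hq₁, hq₂, hq₃]; push_cast; ring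
  · refine ⟨(q₄ : ℤ) + q₁ + q₃ + q₂, ?_⟩
    rw [e2, hq₁, hq₂, hq₃, hq₄]; push_cast; ring

/-- A box whose corners lie on the grid `Bℤ` (`lo = Bα`, `hi + 1 = Bβ` coordinatewise) is a union of `B`-blocks: membership depends only on
`blk B`. [folklore] [cite: Balaban1984PropagatorsII, (2.1) p.224] -/
theorem inBox_iff_of_grid {B : ℕ} (hB : 1 ≤ B) {lo hi : Fin (d + 1) → ℤ} {α β : Fin (d + 1) → ℤ}
    (hlo : ∀ i, lo i = (B : ℤ) * α i) (hhi : ∀ i, hi i + 1 = (B : ℤ) * β i) (x : Fin (d + 1) → ℤ) :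
    InBox lo hi x ↔ ∀ i, α i ≤ blk B x i ∧ blk B x i < β i := by
  have hB0 : (0 : ℤ) < (B : ℤ) := by exact_mod_cast hB
  unfold InBox blk
  refine forall_congr' fun i => ?_
  rw [Int.le_ediv_iff_mul_le hB0, Int.ediv_lt_iff_lt_mul hB0, mul_comm (α i), ← hlo i, mul_comm (β i), ← hhi i,
    Int.lt_add_one_iff]

/-- **Ω_j IS A UNION OF BIG j-BLOCKS** (`1 ≤ j ≤ n`): membership of `y − t` in `□_j` depends only on the big `j`-block of `y`.
[cite: Balaban1985RegularSpaces, p.98 («□_j is a sum of the big blocks»); Balaban1984PropagatorsII, (2.1) p.224] -/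
theorem mem_cube_iff_of_blk_eq {ℓ Mh : ℕ} (hMh : 1 ≤ Mh) (a : Fin (d + 1) → ℤ) {M ρ k n j : ℕ} (hρ : Mh * (ℓ + 1) ∣ ρ)
    (hM : Mh * (ℓ + 1) ∣ M) (hjn : j ≤ n) (hnk : n ≤ k) {y y' : Fin (d + 1) → ℤ}
    (hyy : blk (bigSide ℓ Mh j) y' = blk (bigSide ℓ Mh j) y) :
    y - shift ℓ Mh a ρ k n ∈ cube (ℓ + 1) a M ρ k j ↔ y' - shift ℓ Mh a ρ k n ∈ cube (ℓ + 1) a M ρ k j := by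
  have hB : 1 ≤ bigSide ℓ Mh j := B6MultiLevelBoxOperator.one_le_bigSide hMh j
  choose α hα using fun i => (corners_on_grid a hρ hM hjn hnk i (ℓ := ℓ) (Mh := Mh)).1
  choose β hβ using fun i => (corners_on_grid a hρ hM hjn hnk i (ℓ := ℓ) (Mh := Mh)).2
  -- translate the box `[loC_j, hiC_j]` by `t`
  have key : ∀ z : Fin (d + 1) → ℤ, z - shift ℓ Mh a ρ k n ∈ cube (ℓ + 1) a M ρ k j ↔
      ∀ i, α i ≤ blk (bigSide ℓ Mh j) z i ∧ blk (bigSide ℓ Mh j) z i < β i := by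
    intro z
    rw [mem_cube_iff_inBox a M ρ (hjn.trans hnk)]
    have h1 : InBox (loC (ℓ + 1) a ρ k j) (hiC (ℓ + 1) a M ρ k j) (z - shift ℓ Mh a ρ k n) ↔
        InBox (fun i => loC (ℓ + 1) a ρ k j i + shift ℓ Mh a ρ k n i) (fun i => hiC (ℓ + 1) a M ρ k j i + shift ℓ Mh a ρ k n i) z := by
      unfold InBox
      refine forall_congr' fun i => ?_
      simp only [Pi.sub_apply]
      constructor <;> rintro ⟨h1, h2⟩ <;> constructor <;> linarith
    rw [h1]
    exact inBox_iff_of_grid hB (fun i => hα i) (fun i => by rw [← hβ i]; ring) z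
  rw [key, key, hyy]

/-- The distance across the collar `□_j ∖ □_{j+1}`: a site outside `□_j` and a site in `□_{j+1}` differ by more than `ρLʲ` in some
coordinate (`m_j = m_{j+1} + ρLʲ`). [cite: Balaban1985RegularSpaces, p.98 («a distance between boundaries of these cubes is equal to R₁M₁Lʲη»); Balaban1984PropagatorsII, (2.2) p.224] -/
theorem collar_gap {L : ℕ} (a : Fin (d + 1) → ℤ) {M ρ k j : ℕ} (hjk : j < k) {x x' : Fin (d + 1) → ℤ}
    (hx : x ∉ cube L a M ρ k j) (hx' : x' ∈ cube L a M ρ k (j + 1)) :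
    ∃ i, (ρ : ℤ) * (L : ℤ) ^ j < |x i - x' i| := by
  have hjk' : j + 1 ≤ k := hjk
  rw [mem_cube_iff_inBox a M ρ hjk.le] at hx
  rw [mem_cube_iff_inBox a M ρ hjk'] at hx'
  unfold InBox at hx
  push Not at hx
  obtain ⟨i, hi⟩ := hx
  refine ⟨i, ?_⟩
  obtain ⟨h1, h2⟩ := hx' i
  have hs := fm_succ (L := L) (ρ := ρ) hjk
  have e1 : loC L a ρ k j i = loC L a ρ k (j + 1) i - ((ρ * L ^ j : ℕ) : ℤ) := by
    unfold loC; simp only [bLo]; rw [hs]; push_cast; ring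
  have e2 : hiC L a M ρ k j i = hiC L a M ρ k (j + 1) i + ((ρ * L ^ j : ℕ) : ℤ) := by
    unfold hiC; simp only [bHi]; rw [hs]; push_cast; ring
  have hnn : (0 : ℤ) ≤ (ρ : ℤ) * (L : ℤ) ^ j := by positivity
  by_cases hlo : loC L a ρ k j i ≤ x i
  · have h3 := hi hlo
    rw [e2] at h3
    push_cast at h3
    rw [abs_of_nonneg (by linarith)]
    linarith
  · push Not at hlo
    rw [e1] at hlo
    push_cast at hlo
    rw [abs_of_nonpos (by linarith)]
    linarith

/-- `fm 1 + ρL ≤ fm n + ρLⁿ` (`1 ≤ n ≤ k`, `L ≥ 2`): the outer margins beyond `□_n` add up to less than `ρLⁿ`. [cite: Balaban1985RegularSpaces, p.98 («Σ_{j=0}^{k} R₁M₁Lʲη < (1 − L⁻¹)⁻¹R₁M₁Lᵏη ≤ 2R₁M₁Lᵏη»)] -/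
theorem fm_one_le {L ρ k : ℕ} (hL : 2 ≤ L) : ∀ {n : ℕ}, 1 ≤ n → n ≤ k → fm L ρ k 1 + ρ * L ≤ fm L ρ k n + ρ * L ^ n := by
  intro n hn hnk
  induction n with
  | zero => exact absurd hn (by norm_num)
  | succ m ih =>
    rcases Nat.eq_zero_or_pos m with h0 | hpos
    · subst h0; simp
    · have h1 := ih hpos (Nat.le_of_succ_le hnk)
      have h2 : fm L ρ k m = fm L ρ k (m + 1) + ρ * L ^ m := fm_succ (Nat.lt_of_succ_le hnk)
      have h3 : ρ * L ^ m + ρ * L ^ m ≤ ρ * L ^ (m + 1) := by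
        rw [pow_succ]
        calc ρ * L ^ m + ρ * L ^ m = ρ * (L ^ m * 2) := by ring
          _ ≤ ρ * (L ^ m * L) := Nat.mul_le_mul_left _ (Nat.mul_le_mul_left _ hL)
      omega

/-- `fm 1 ≤ ρ·L^{k+1}` (`L ≥ 2`, `1 ≤ k`). [cite: Balaban1985RegularSpaces, p.98 («Σ_{j=0}^{k} R₁M₁Lʲη … ≤ 2R₁M₁Lᵏη»)] -/
theorem fm_one_le_top {L ρ k : ℕ} (hL : 2 ≤ L) (hk : 1 ≤ k) : fm L ρ k 1 ≤ ρ * L ^ (k + 1) := by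
  have h := fm_one_le (ρ := ρ) hL hk le_rfl
  have htop : fm L ρ k k = ρ * L ^ k := by unfold fm; rw [Nat.sub_self, B8Eq131Cubes.gs_zero, mul_one, mul_comm]
  rw [htop] at h
  have h3 : ρ * L ^ k + ρ * L ^ k ≤ ρ * L ^ (k + 1) := by
    rw [pow_succ]
    calc ρ * L ^ k + ρ * L ^ k = ρ * (L ^ k * 2) := by ring
      _ ≤ ρ * (L ^ k * L) := Nat.mul_le_mul_left _ (Nat.mul_le_mul_left _ hL)
  have : ρ * L ≥ 0 := Nat.zero_le _
  omega


/-! ## §3 The member of the [B6] §2 Neumann-box family -/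

/-- The margins decrease inwards: `fm n ≤ fm 1` (`1 ≤ n ≤ k`). [cite: Balaban1985RegularSpaces, p.98] -/
theorem fm_le_fm_one {L ρ k n : ℕ} (hn : 1 ≤ n) (hnk : n ≤ k) : fm L ρ k n ≤ fm L ρ k 1 := by
  rcases Nat.lt_or_ge 1 n with hlt | hge
  · exact le_trans (Nat.le_add_right _ _) (fm_add_le hlt hnk)
  · rw [le_antisymm hge hn]

/-- The presentation identity `Lⁿ·L·M_h·P = M_hL^{n+1}ρ + M_hL^{k+1}M + 2M_hL^{k+1}ρ` (`n ≤ k`). [folklore] [cite: Balaban1984PropagatorsII, (2.1) p.224] -/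
theorem N0_boxP_eq {ℓ Mh M ρ k n : ℕ} (hnk : n ≤ k) (i : Fin (d + 1)) :
    N0 ℓ Mh n (boxP ℓ M ρ k n) i = Mh * (ℓ + 1) ^ (n + 1) * ρ + Mh * (ℓ + 1) ^ (k + 1) * M + 2 * (Mh * (ℓ + 1) ^ (k + 1) * ρ) := by
  obtain ⟨e, rfl⟩ := Nat.exists_eq_add_of_le hnk
  simp only [N0, boxP, Nat.add_sub_cancel_left, pow_add, pow_succ]
  ring

/-- **THE TRANSLATED `□₁` LIES IN THE BOX `X = Π_μ[0, Lⁿ·L·M_h·P_μ)`** (`L ≥ 2`, `M_h ≥ 1`, `1 ≤ n ≤ k`).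
[cite: Balaban1984PropagatorsII, (2.1) p.224 («Ω_j ⊂ T_η»); Balaban1985RegularSpaces, p.98] -/
theorem mem_boxDom_of_mem_cube {ℓ Mh : ℕ} (hℓ : 1 ≤ ℓ) (hMh : 1 ≤ Mh) (a : Fin (d + 1) → ℤ) {M ρ k n : ℕ} (hn : 1 ≤ n) (hnk : n ≤ k)
    {x : Fin (d + 1) → ℤ} (hx : x ∈ cube (ℓ + 1) a M ρ k 1) :
    x + shift ℓ Mh a ρ k n ∈ boxDom (N0 ℓ Mh n (boxP ℓ M ρ k n)) := by
  have hL2 : 2 ≤ ℓ + 1 := by omega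
  rw [mem_boxDom]
  intro i
  rw [mem_cube_iff_inBox a M ρ (hn.trans hnk)] at hx
  obtain ⟨h1, h2⟩ := hx i
  -- the two corner identities
  have e1 : loC (ℓ + 1) a ρ k 1 i + shift ℓ Mh a ρ k n i
      = ((Mh * (ℓ + 1) ^ (n + 1) * ρ : ℕ) : ℤ) + (fm (ℓ + 1) ρ k n : ℤ) - (fm (ℓ + 1) ρ k 1 : ℤ) := by
    unfold shift loC; simp only [bLo]; push_cast; ring
  have e2 : hiC (ℓ + 1) a M ρ k 1 i + 1 + shift ℓ Mh a ρ k n i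
      = (((ℓ + 1) ^ k * M : ℕ) : ℤ) + (fm (ℓ + 1) ρ k 1 : ℤ) + ((Mh * (ℓ + 1) ^ (n + 1) * ρ : ℕ) : ℤ) + (fm (ℓ + 1) ρ k n : ℤ) := by
    unfold shift hiC loC; simp only [bHi, bLo]; push_cast; ring
  -- natural-number bounds on the margins
  have hA : fm (ℓ + 1) ρ k 1 ≤ fm (ℓ + 1) ρ k n + Mh * (ℓ + 1) ^ (n + 1) * ρ := by
    have h := fm_one_le (L := ℓ + 1) (ρ := ρ) (k := k) hL2 hn hnk
    have h' : ρ * (ℓ + 1) ^ n ≤ Mh * (ℓ + 1) ^ (n + 1) * ρ := by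
      calc ρ * (ℓ + 1) ^ n = 1 * (ℓ + 1) ^ n * ρ := by ring
        _ ≤ Mh * (ℓ + 1) ^ (n + 1) * ρ :=
          Nat.mul_le_mul (Nat.mul_le_mul hMh (Nat.pow_le_pow_right (Nat.succ_pos ℓ) (Nat.le_succ n))) le_rfl
    omega
  have hB : fm (ℓ + 1) ρ k 1 ≤ Mh * (ℓ + 1) ^ (k + 1) * ρ := by
    calc fm (ℓ + 1) ρ k 1 ≤ ρ * (ℓ + 1) ^ (k + 1) := fm_one_le_top hL2 (hn.trans hnk)
      _ = 1 * (ℓ + 1) ^ (k + 1) * ρ := by ring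
      _ ≤ Mh * (ℓ + 1) ^ (k + 1) * ρ := Nat.mul_le_mul (Nat.mul_le_mul hMh le_rfl) le_rfl
  have hC : fm (ℓ + 1) ρ k n ≤ fm (ℓ + 1) ρ k 1 := fm_le_fm_one hn hnk
  have hD : (ℓ + 1) ^ k * M ≤ Mh * (ℓ + 1) ^ (k + 1) * M := by
    calc (ℓ + 1) ^ k * M = 1 * (ℓ + 1) ^ k * M := by ring
      _ ≤ Mh * (ℓ + 1) ^ (k + 1) * M :=
        Nat.mul_le_mul (Nat.mul_le_mul hMh (Nat.pow_le_pow_right (Nat.succ_pos ℓ) (Nat.le_succ k))) le_rfl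
  have hN := N0_boxP_eq (ℓ := ℓ) (Mh := Mh) (M := M) (ρ := ρ) hnk i
  have hup : (ℓ + 1) ^ k * M + fm (ℓ + 1) ρ k 1 + Mh * (ℓ + 1) ^ (n + 1) * ρ + fm (ℓ + 1) ρ k n
      ≤ N0 ℓ Mh n (boxP ℓ M ρ k n) i := by
    rw [hN]; omega
  constructor
  · -- `0 ≤ loC₁ + t ≤ x + t`
    have h3 : (0 : ℤ) ≤ loC (ℓ + 1) a ρ k 1 i + shift ℓ Mh a ρ k n i := by
      rw [e1]
      have : ((fm (ℓ + 1) ρ k 1 : ℕ) : ℤ) ≤ ((fm (ℓ + 1) ρ k n + Mh * (ℓ + 1) ^ (n + 1) * ρ : ℕ) : ℤ) := by exact_mod_cast hA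
      rw [Nat.cast_add] at this
      linarith
    simp only [Pi.add_apply]
    linarith
  · -- `x + t ≤ hiC₁ + t < N₀`
    have h3 : hiC (ℓ + 1) a M ρ k 1 i + 1 + shift ℓ Mh a ρ k n i ≤ (N0 ℓ Mh n (boxP ℓ M ρ k n) i : ℤ) := by
      rw [e2]; exact_mod_cast hup
    simp only [Pi.add_apply]
    linarith

/-- `R·(M_hL^{j+1}) ≤ ρ·Lʲ` when `R·M_hL ≤ ρ`. [cite: Balaban1984PropagatorsII, (2.2) p.224; Balaban1985RegularSpaces, p.98] -/
theorem R_bigSide_le {ℓ Mh ρ R : ℕ} (hR : R * (Mh * (ℓ + 1)) ≤ ρ) (j : ℕ) : R * bigSide ℓ Mh j ≤ ρ * (ℓ + 1) ^ j := by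
  calc R * bigSide ℓ Mh j = R * (Mh * (ℓ + 1)) * (ℓ + 1) ^ j := by unfold bigSide; ring
    _ ≤ ρ * (ℓ + 1) ^ j := Nat.mul_le_mul_right _ hR

/-- **THE INNER CUBE FAMILY `□₁ ⊃ … ⊃ □_n` (TRANSLATED BY `t`) IS A MEMBER OF THE [B6] §2 NEUMANN-BOX FAMILY `Domains d ℓ M_h n P R`**:
levels `1 … n` (`Ω_j = t + □_j` for `2 ≤ j ≤ n`, `Ω₁ = X ⊇ t + □₁`), (2.1) the `□_j` are unions of big `j`-blocks (collar `ρ = R₁M₁` and core side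
`M` multiples of the big-block size `M_hL`), (2.2) `dist(Ω_jᶜ, Ω_{j+1}) > R·M_hL^{j+1}` (from `R·M_hL ≤ ρ`: the collar between `□_j` and `□_{j+1}` has
width `ρLʲ`).  Print: «for every j the cube □_j is a sum of the big blocks of the lattice T_{L^{−j}} … a distance between boundaries of these cubes is
equal to R₁M₁Lʲη», «R₁, M₁ are smallest integers for which all the theorems of the papers [2, 4] are valid».
[cite: Balaban1985RegularSpaces, p.98, (1.131) p.99; Balaban1984PropagatorsII, (2.1)–(2.4) p.224] -/
def cubeDomains {ℓ Mh : ℕ} (hMh : 1 ≤ Mh) (a : Fin (d + 1) → ℤ) {M ρ k n R : ℕ} (hn : 1 ≤ n) (hnk : n ≤ k)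
    (hρ : Mh * (ℓ + 1) ∣ ρ) (hM : Mh * (ℓ + 1) ∣ M) (hρ0 : 0 < ρ) (hR : R * (Mh * (ℓ + 1)) ≤ ρ) :
    Domains d ℓ Mh n (boxP ℓ M ρ k n) R where
  lev := lev ℓ Mh a M ρ k n
  one_le_lev := one_le_lev ℓ Mh a M ρ k n
  lev_le := lev_le ℓ Mh a M ρ k hn
  bigBlocks := by
    have hρL : ℓ + 1 ≤ ρ := le_trans (Nat.le_mul_of_pos_left _ hMh) (Nat.le_of_dvd hρ0 hρ)
    intro j hj y _ y' _ hyy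
    by_cases hjn : j ≤ n
    · rw [le_lev_iff a M hρL hnk (by omega) hjn y (fun h => by omega),
        le_lev_iff a M hρL hnk (by omega) hjn y' (fun h => by omega)]
      exact mem_cube_iff_of_blk_eq hMh a hρ hM hjn hnk hyy
    · have h1 := lev_le ℓ Mh a M ρ k hn y
      have h2 := lev_le ℓ Mh a M ρ k hn y'
      constructor <;> intro h <;> omega
  sep := by
    have hρL : ℓ + 1 ≤ ρ := le_trans (Nat.le_mul_of_pos_left _ hMh) (Nat.le_of_dvd hρ0 hρ)
    intro j y _ y' _ hlt hle
    have h1 := one_le_lev ℓ Mh a M ρ k n y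
    have h2 := lev_le ℓ Mh a M ρ k hn y'
    have hjn : j + 1 ≤ n := le_trans hle h2
    have hy' : y' - shift ℓ Mh a ρ k n ∈ cube (ℓ + 1) a M ρ k (j + 1) :=
      (le_lev_iff a M hρL hnk (by omega) hjn y' (fun h => by omega)).mp hle
    have hy : y - shift ℓ Mh a ρ k n ∉ cube (ℓ + 1) a M ρ k j := not_mem_of_lev_lt a M ρ k y hlt (by omega)
    obtain ⟨i, hi⟩ := collar_gap a (lt_of_lt_of_le (Nat.lt_of_succ_le hjn) hnk) hy hy'
    have hsub : (y - shift ℓ Mh a ρ k n) i - (y' - shift ℓ Mh a ρ k n) i = (y - y') i := by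
      simp only [Pi.sub_apply]; ring
    rw [hsub] at hi
    have hRle : ((R * bigSide ℓ Mh j : ℕ) : ℝ) ≤ ((ρ * (ℓ + 1) ^ j : ℕ) : ℝ) := by exact_mod_cast R_bigSide_le hR j
    have hi' : ((ρ * (ℓ + 1) ^ j : ℕ) : ℝ) < ((|(y - y') i| : ℤ) : ℝ) := by
      have : ((ρ : ℤ) * ((ℓ + 1 : ℕ) : ℤ) ^ j) < |(y - y') i| := by exact_mod_cast hi
      exact_mod_cast this
    exact lt_of_le_of_lt hRle (lt_of_lt_of_le hi' (abs_le_supNorm (y - y') i))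

/-- The level function of the member is `lev`. [cite: Balaban1984PropagatorsII, (2.3)–(2.4) p.224] -/
theorem cubeDomains_lev {ℓ Mh : ℕ} (hMh : 1 ≤ Mh) (a : Fin (d + 1) → ℤ) {M ρ k n R : ℕ} (hn : 1 ≤ n) (hnk : n ≤ k)
    (hρ : Mh * (ℓ + 1) ∣ ρ) (hM : Mh * (ℓ + 1) ∣ M) (hρ0 : 0 < ρ) (hR : R * (Mh * (ℓ + 1)) ≤ ρ) :
    (cubeDomains hMh a hn hnk hρ hM hρ0 hR).lev = lev ℓ Mh a M ρ k n := rfl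

/-! ## §4 Dictionary with the tower levels of the cube member (`B8CubeMemberZd.cubeLamS`) -/

open Literature.MathematicalPhysics.QuantumLattice (blockMap)
open B8CubeMemberZd (cubeLamS)
open B8Eq131CubesAdmissible (cubeFam cubeFam_false_of_le)
open B8Eq191FlatDirichletDepth (mem_cube_of_le_tower not_mem_cube_of_tower_lt)
open B8Eq191FlatDirichletConjugation (cover_cubeMember)

/-- Translating and translating back. [folklore] [cite: Balaban1984PropagatorsII, (2.3) p.224] -/
theorem add_shift_sub_shift (ℓ Mh : ℕ) (a : Fin (d + 1) → ℤ) (ρ k n : ℕ) (x : Fin (d + 1) → ℤ) :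
    x + shift ℓ Mh a ρ k n - shift ℓ Mh a ρ k n = x := add_sub_cancel_right x _

open Classical in
/-- **THE LEVEL OF A TRANSLATED SITE IS ITS TOWER LEVEL**: if the `Lʲ`-block of `x ∈ □₁` is a restriction block of the truncation-`n` tower
(`blockMap (Lʲ) x ∈ cubeLamS … n j`), then `lev (x + t) = j` (and `1 ≤ j`). [cite: Balaban1985RegularSpaces, (1.5)–(1.6) p.77, (1.68) p.88, (1.131) p.99; Balaban1984PropagatorsII, (2.3)–(2.4) p.224] -/
theorem lev_eq_of_tower {ℓ Mh : ℕ} (a : Fin (d + 1) → ℤ) (M : ℕ) {ρ k n j : ℕ} (hρ : ℓ + 1 ≤ ρ) (hn : 1 ≤ n) (hnk : n ≤ k) (hjn : j ≤ n)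
    {x : Fin (d + 1) → ℤ} (hx1 : x ∈ cube (ℓ + 1) a M ρ k 1) (hxj : blockMap ((ℓ + 1) ^ j) x ∈ cubeLamS (ℓ + 1) a M ρ k n j) :
    1 ≤ j ∧ lev ℓ Mh a M ρ k n (x + shift ℓ Mh a ρ k n) = j := by
  have hL : 1 ≤ ℓ + 1 := Nat.succ_pos ℓ
  have hj1 : 1 ≤ j := by
    by_contra h0
    have hj0 : j = 0 := by omega
    subst hj0
    exact not_mem_cube_of_tower_lt hL a M hρ hnk (by omega) Nat.zero_lt_one (hn.trans hnk) hxj hx1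
  refine ⟨hj1, ?_⟩
  unfold lev
  rw [add_shift_sub_shift]
  have hfg : Nat.findGreatest (fun j => x ∈ cube (ℓ + 1) a M ρ k j) n = j := by
    rw [Nat.findGreatest_eq_iff]
    refine ⟨hjn, fun _ => mem_cube_of_le_tower hL a M hρ hnk hjn le_rfl hxj, fun m hjm hmn => ?_⟩
    rcases Nat.lt_or_ge j n with hlt | hge
    · exact not_mem_cube_of_tower_lt hL a M hρ hnk hlt hjm (hmn.trans hnk) hxj
    · exact absurd (lt_of_lt_of_le hjm hmn) (not_lt.mpr hge)
  rw [hfg]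
  exact max_eq_right hj1

open Classical in
/-- **CONVERSELY**: for `x ∈ □₁` the `L^{lev(x+t)}`-block of `x` is a restriction block of the truncation-`n` tower, and it is the only tower level of
`x` («every site of □₀ lies in exactly one tower», `cover_cubeMember` ∕ `towers_disjoint_cube`). [cite: Balaban1985RegularSpaces, (1.5)–(1.6) p.77, (1.68) p.88, (1.131) p.99] -/
theorem tower_iff_lev_eq {ℓ Mh : ℕ} (a : Fin (d + 1) → ℤ) (M : ℕ) {ρ k n j : ℕ} (hρ : ℓ + 1 ≤ ρ) (hn : 1 ≤ n) (hnk : n ≤ k) (hjn : j ≤ n)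
    {x : Fin (d + 1) → ℤ} (hx1 : x ∈ cube (ℓ + 1) a M ρ k 1) :
    blockMap ((ℓ + 1) ^ j) x ∈ cubeLamS (ℓ + 1) a M ρ k n j ↔ lev ℓ Mh a M ρ k n (x + shift ℓ Mh a ρ k n) = j := by
  have hL : 1 ≤ ℓ + 1 := Nat.succ_pos ℓ
  constructor
  · exact fun h => (lev_eq_of_tower a M hρ hn hnk hjn hx1 h).2
  · intro h
    have hx0 : x ∈ cubeFam false (ℓ + 1) a M ρ k 0 := by
      have h1 : x ∈ cubeFam false (ℓ + 1) a M ρ k 1 := by rw [cubeFam_false_of_le _ a M ρ (hn.trans hnk)]; exact hx1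
      exact B8CubeMemberZd.hΩ_cubeFam hL a M hρ k 0 h1
    obtain ⟨j', hj'n, hj'⟩ := cover_cubeMember hL a M hρ hnk x hx0
    have h2 := (lev_eq_of_tower a M hρ hn hnk hj'n hx1 hj' (Mh := Mh)).2
    rw [h] at h2
    subst h2
    exact hj'

/-! ## §5 [4] Theorem 3.1 ∕ B8 (1.101) at `U₀ = 1` on the Neumann box hosting `□₁ ⊃ … ⊃ □_n` — r05's hypothesis-free theorem read at the member -/

open B6MultiLevelBoxOperator (gml)
open B6Prop22DerivMultiLevelBox (dMat)
open B4BoxCov237 (opBoxR)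
open B6Ineq243TwoLevelBox (aNext)
open B8Ineq198MultiLevelBox (ineq1101_multiLevelBox_two)
open scoped Matrix

/-- **(1.101) ON THE NEUMANN BOX `X ⊇ t + □₁` CARRYING THE CUBE MEMBER'S LEVELS `1 … n`** («G′ is a bounded operator from a space with the norm
|·|₍₋₂₎ into a space with the norm |·| for functions, and the norm |·|₍₋₁₎ for their first derivatives», B8 p. 93; [4] Thm 3.1 at `U = 1`):
r05's HYPOTHESIS-FREE `B8Ineq198MultiLevelBox.ineq1101_multiLevelBox_two` (over p21's Prop. 2.2 `B6Prop22AllMultiLevelBox.prop22_entries1236_multiLevelBox`)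
READ AT THE MEMBER `cubeDomains`: there are `C′, M₀ > 0`, `N₀ ≥ 1` (functions of `d, ℓ` and the weight windows only) such that for every
`M_h ≥ 3` with `M₀ ≤ L·M_h`, every cube datum with `M_hL ∣ ρ`, `M_hL ∣ M`, `R·M_hL ≤ ρ`, `2L ≤ R`, `N₀ + 1 ≤ R·L·M_h`, every weight sequence in the
windows with the recursion `a_{i+1} = aNext ℓ a_i c_i`, every `f` on `X` with `|f(z)| ≤ S·(L^{lev z})⁻²` and every `x ∈ X`:
`|(G′f)(x)| ≤ C′S`, `|(∂_μG′f)(x)|, |(G′∂*_μf)(x)| ≤ C′(L^{lev x})⁻¹S`, `|((−Δ^N)G′f)(x)| ≤ C′(L^{lev x})⁻²S`, `G′ = gml` the inverse of p21's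
`mlOp` with level function `lev` (= the cube member's tower level on `t + □₁`, §4).  Nothing new is proved here: this is the cited theorem, by `exact`.
[cite: Balaban1985RegularSpaces, (1.101) p.93, p.98; Balaban1985BackgroundPropagators, Theorem 3.1 (3.42) p.397, (3.47) p.398; Balaban1984PropagatorsII, Prop. 2.2 (2.67) p.234, (2.1)–(2.2) p.224] -/
theorem ineq1101_regionA (d ℓ : ℕ) (hℓ : 1 ≤ ℓ) (aminus aplus a2minus a2plus : ℝ) (ha : 0 < aminus) (ha2 : 0 < a2minus) :
    ∃ C' M₀ : ℝ, ∃ N₀ : ℕ, 0 < C' ∧ 0 < M₀ ∧ 0 < N₀ ∧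
      ∀ (Mh : ℕ) (hMh : 3 ≤ Mh), M₀ ≤ ((ℓ : ℝ) + 1) * Mh →
      ∀ (a : Fin (d + 1) → ℤ) (M ρ k n R : ℕ) (hn : 1 ≤ n) (hnk : n ≤ k) (hρ : Mh * (ℓ + 1) ∣ ρ) (hM : Mh * (ℓ + 1) ∣ M)
        (hρ0 : 0 < ρ) (hR : R * (Mh * (ℓ + 1)) ≤ ρ), 2 * (ℓ + 1) ≤ R → N₀ + 1 ≤ R * ((ℓ + 1) * Mh) →
      ∀ (aw c : ℕ → ℝ), (∀ i, 1 ≤ i → aminus ≤ aw i ∧ aw i ≤ aplus) → (∀ i, 1 ≤ i → a2minus ≤ c i ∧ c i ≤ a2plus) →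
        (∀ i, 1 ≤ i → aw (i + 1) = aNext ℓ (aw i) (c i)) →
        ∀ (f : ↥(boxDom (N0 ℓ Mh n (boxP ℓ M ρ k n))) → ℝ) (S : ℝ), 0 ≤ S →
          (∀ z : ↥(boxDom (N0 ℓ Mh n (boxP ℓ M ρ k n))), |f z| ≤ S * ((((ℓ : ℝ) + 1) ^ lev ℓ Mh a M ρ k n z.1) ^ 2)⁻¹) →
          ∀ x : ↥(boxDom (N0 ℓ Mh n (boxP ℓ M ρ k n))),
            |(gml (N0 ℓ Mh n (boxP ℓ M ρ k n)) ℓ n (lev ℓ Mh a M ρ k n) aw *ᵥ f) x| ≤ C' * S ∧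
            (∀ μ : Fin (d + 1), |(dMat (N0 ℓ Mh n (boxP ℓ M ρ k n)) μ *ᵥ
                (gml (N0 ℓ Mh n (boxP ℓ M ρ k n)) ℓ n (lev ℓ Mh a M ρ k n) aw *ᵥ f)) x| ≤
              C' * (((ℓ : ℝ) + 1) ^ lev ℓ Mh a M ρ k n x.1)⁻¹ * S) ∧
            (∀ μ : Fin (d + 1), |(gml (N0 ℓ Mh n (boxP ℓ M ρ k n)) ℓ n (lev ℓ Mh a M ρ k n) aw *ᵥ
                ((dMat (N0 ℓ Mh n (boxP ℓ M ρ k n)) μ)ᵀ *ᵥ f)) x| ≤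
              C' * (((ℓ : ℝ) + 1) ^ lev ℓ Mh a M ρ k n x.1)⁻¹ * S) ∧
            |(opBoxR 1 0 0 1 (N0 ℓ Mh n (boxP ℓ M ρ k n)) *ᵥ
                (gml (N0 ℓ Mh n (boxP ℓ M ρ k n)) ℓ n (lev ℓ Mh a M ρ k n) aw *ᵥ f)) x| ≤
              C' * ((((ℓ : ℝ) + 1) ^ lev ℓ Mh a M ρ k n x.1) ^ 2)⁻¹ * S := by
  obtain ⟨C', M₀, N₀, hC', hM₀, hN₀, h⟩ := ineq1101_multiLevelBox_two d ℓ hℓ aminus aplus a2minus a2plus ha ha2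
  refine ⟨C', M₀, N₀, hC', hM₀, hN₀, ?_⟩
  intro Mh hMh hM0 a M ρ k n R hn hnk hρ hM hρ0 hR hR2 hRN aw c haw hc hrec f S hS hf x
  have hP : ∀ μ : Fin (d + 1), 1 ≤ boxP (d := d) ℓ M ρ k n μ := fun μ => le_trans hρ0 (Nat.le_add_right _ _)
  exact h n Mh R hMh hM0 hR2 hRN (boxP ℓ M ρ k n) hP (cubeDomains (by omega) a hn hnk hρ hM hρ0 hR) aw c haw hc hrec f S hS hf x

end Literature.MathematicalPhysics.QuantumFieldTheory.Balaban1983to89.B8CubeMemberBoxDomains
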